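import Summits.SmoothPoincare4.SmoothPoincare4.Theorems.SblfDescentRungOneStubSliceRecognitionAux1
import Literature.Topology.FourManifolds.CerfGammaFourProofs

/-!
# Four-sphere recognition from a slice-preserving genus-one gluing, III: slice-preserving
# diffeomorphisms of `S² × S¹` as circle-families in `Diff(S²)`, and isotopies from paths of
# families — helpers for stub `stub_sliceRecognition` of line `Sketch`, crux `SblfDescent.RungOne`

(Crux item stmt-SmoothPoincare4-18531; skeleton `Cruxes/RungOne/Lines/Sketch.lean`.)

The common boundary `∂W₀ ≡ ∂V₀ = {x ∈ S | x₃² + x₄² = 1/2}` of the two tubes of the genus-one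
splitting of the level sphere `S ⊆ ℝ⁵` is `S²(1/√2) × S¹(1/√2)`, with coordinates
`θ(x) = √2 (x₀, x₁, x₂) ∈ S²` and `w(x) = (x₃, x₄)`, `|w|² = 1/2` (`SphereFourSplitting.invHead`,
`invTail`; part I, `…StubSliceRecognitionAux1.lean`).

* `helper_sliceRec_family` (registered helper) — **a diffeomorphism `φ : ∂W₀ ≅ ∂V₀` preserving
  `x₃, x₄` is the suspension of a smooth circle-family of diffeomorphisms of `S²`**: there are
  jointly smooth, mutually inverse families `g, g⁻¹ : 𝕊¹ × S² → S²` with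
  `θ(φ z) = g_{u(z)} (θ z)`, `w(φ z) = w(z)`, `u(z) = √2 w(z) ∈ 𝕊¹`
  (`g_u θ = θ(φ(θ/√2, u/√2))`).
* `helper_sliceRec_isotopy` — **a jointly smooth path `H_t` (`t ∈ ℝ`) of such families, with a
  jointly smooth path of fibrewise inverses, suspends to a smooth isotopy of diffeomorphisms
  `∂W₀ ≅ ∂V₀`**: given a diffeomorphism `χ₀` which is the suspension of `H_0`, there is a
  diffeomorphism `χ₁`, the suspension of `H_1`, smoothly isotopic to `χ₀`
  (`Literature.Topology.FourManifolds.IsSmoothlyIsotopic`, Hirsch 1976, Ch. 8 §1: the stages are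
  the suspensions of the `H_t`, diffeomorphisms, hence smooth embeddings,
  `Diffeomorph.isSmoothEmbedding'`).

Smoothness into the carriers is through the lifting lemmas of part I (Lee 2013, Cor. 5.30);
points of the carriers are compared through `(θ, w)` (`boundaryW_ext`,
`helper_sliceRec_carriers`).  Everything is proved; no definitions, no named facts, no local
notation.

## References

* M. W. Hirsch, *Differential Topology*, GTM 33 (1976), Ch. 8 §1 (isotopy), §2 (gluing).
  [HirschDT1976]
* J. M. Lee, *Introduction to Smooth Manifolds* (2013), Cor. 5.30. [LeeSmoothManifolds2013]
-/

-- the prescribed namespace `Summit.<P>.<Sub>.…` duplicates `SmoothPoincare4` (P = Sub)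
set_option linter.dupNamespace false

noncomputable section

open scoped Manifold ContDiff Topology
open Set Function Literature.Topology.FourManifolds SphereFourSplitting

namespace Summit.SmoothPoincare4.SmoothPoincare4.Cruxes.RungOne.Sketch

/-! ### Unit tails and scaled circle points -/

/-- `|u/√2|² = 1/2` for a unit vector `u ∈ 𝕊¹`. [folklore] -/
theorem sq2_smul_sphere (u : Metric.sphere (0 : EuclideanSpace ℝ (Fin 2)) 1) :
    sq2 ((Real.sqrt 2)⁻¹ • (u : EuclideanSpace ℝ (Fin 2))) = 1 / 2 := by
  rw [sq2_eq_norm_sq, norm_smul, norm_inv, Real.norm_eq_abs, abs_of_nonneg (Real.sqrt_nonneg 2),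
    norm_eq_of_mem_sphere u, mul_one, inv_pow, Real.sq_sqrt zero_le_two, one_div]

/-- `√2 · (u/√2) = u`. [folklore] -/
theorem sqrt_two_smul_inv_smul (v : EuclideanSpace ℝ (Fin 2)) :
    Real.sqrt 2 • ((Real.sqrt 2)⁻¹ • v) = v := by
  rw [smul_smul, mul_inv_cancel₀ (Real.sqrt_ne_zero'.2 two_pos), one_smul]

/-- `(√2 · w)/√2 = w`. [folklore] -/
theorem inv_smul_sqrt_two_smul (v : EuclideanSpace ℝ (Fin 2)) :
    (Real.sqrt 2)⁻¹ • (Real.sqrt 2 • v) = v := by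
  rw [smul_smul, inv_mul_cancel₀ (Real.sqrt_ne_zero'.2 two_pos), one_smul]

/-- The tail `w(x)` of a point of the common boundary is determined by the coordinates `x₃, x₄`
(the radial factor being `1/√2` on both carriers). [folklore] -/
theorem invTail_eq_of_coord_eq (z z' : (𝓡∂ 4).boundary EquatorTube)
    (h3 : ι (ιW z.1) 3 = ι (ιW z'.1) 3) (h4 : ι (ιW z.1) 4 = ι (ιW z'.1) 4) :
    invTail z.1 = invTail z'.1 := by
  have hr : rad z.1 = rad z'.1 := by rw [rad_boundaryW, rad_boundaryW]
  ext i
  fin_cases i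
  · show invTail z.1 0 = invTail z'.1 0
    rw [invTail_apply_zero, invTail_apply_zero, hr, h3]
  · show invTail z.1 1 = invTail z'.1 1
    rw [invTail_apply_one, invTail_apply_one, hr, h4]

/-- The unit tail `z ↦ √2 w(z) : ∂W₀ → 𝕊¹` is smooth. [folklore] -/
theorem contMDiff_unitTail_boundaryW :
    ContMDiff (𝓡 3) (𝓡 1) ∞ (Set.codRestrict
      (fun z : (𝓡∂ 4).boundary EquatorTube => Real.sqrt 2 • invTail z.1)
      (Metric.sphere (0 : EuclideanSpace ℝ (Fin 2)) 1) sqrt_two_smul_invTail_mem_sphere) := by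
  haveI := fact_finrank_euclideanSpace_succ 1
  exact ((contDiff_const_smul (Real.sqrt 2)).comp_contMDiff
    contMDiff_invTail_boundaryW).codRestrict_sphere _

/-- The unit tail of a point of `∂V₀` lies on the unit circle. [folklore] -/
theorem sqrt_two_smul_invTail_mem_sphere_V (z : (𝓡∂ 4).boundary PolarTube) :
    Real.sqrt 2 • invTail ((RegularSublevel.splitDiffeomorph isRegularLevel_tubeS).symm z).1 ∈
      Metric.sphere (0 : EuclideanSpace ℝ (Fin 2)) 1 :=
  sqrt_two_smul_invTail_mem_sphere _

/-- The unit tail `z ↦ √2 w(z) : ∂V₀ → 𝕊¹` is smooth. [folklore] -/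
theorem contMDiff_unitTail_boundaryV :
    ContMDiff (𝓡 3) (𝓡 1) ∞ (Set.codRestrict
      (fun z : (𝓡∂ 4).boundary PolarTube =>
        Real.sqrt 2 • invTail ((RegularSublevel.splitDiffeomorph isRegularLevel_tubeS).symm z).1)
      (Metric.sphere (0 : EuclideanSpace ℝ (Fin 2)) 1) sqrt_two_smul_invTail_mem_sphere_V) := by
  haveI := fact_finrank_euclideanSpace_succ 1
  exact ((contDiff_const_smul (Real.sqrt 2)).comp_contMDiff
    contMDiff_invTail_boundaryV).codRestrict_sphere _

/-! ### A slice-preserving diffeomorphism is the suspension of a circle-family -/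

/-- **Registered helper `helper_sliceRec_family`: a slice-preserving diffeomorphism
`φ : ∂W₀ ≅ ∂V₀` is the suspension of a smooth circle-family of diffeomorphisms of `S²`.**
With `g_u θ := θ(φ(θ/√2, u/√2))` and `g⁻¹_u θ := θ(φ⁻¹(θ/√2, u/√2))` (`u ∈ 𝕊¹`, `θ ∈ S²`):
both families are jointly smooth (lifts into the carriers, Lee 2013, Cor. 5.30, and smoothness
of `θ(·)`), mutually inverse fibrewise (`φ` preserves `w`), and `φ` is recovered as
`θ(φ z) = g_{√2 w(z)} (θ z)`, `w(φ z) = w(z)`. [cite: HirschDT1976, Ch. 8 §2] -/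
theorem helper_sliceRec_family : ∀ φ : (𝓡∂ 4).boundary EquatorTube ≃ₘ⟮𝓡 3, 𝓡 3⟯ (𝓡∂ 4).boundary PolarTube, (∀ z, ι (ιV (φ z).1) 3 = ι (RegularSublevel.incl isRegularLevel_tubeS z.1) 3 ∧ ι (ιV (φ z).1) 4 = ι (RegularSublevel.incl isRegularLevel_tubeS z.1) 4) → ∃ g gi : Metric.sphere (0 : EuclideanSpace ℝ (Fin 2)) 1 → Metric.sphere (0 : EuclideanSpace ℝ (Fin 3)) 1 → Metric.sphere (0 : EuclideanSpace ℝ (Fin 3)) 1, ContMDiff ((𝓡 1).prod (𝓡 2)) (𝓡 2) ∞ (fun p : Metric.sphere (0 : EuclideanSpace ℝ (Fin 2)) 1 × Metric.sphere (0 : EuclideanSpace ℝ (Fin 3)) 1 => g p.1 p.2) ∧ ContMDiff ((𝓡 1).prod (𝓡 2)) (𝓡 2) ∞ (fun p : Metric.sphere (0 : EuclideanSpace ℝ (Fin 2)) 1 × Metric.sphere (0 : EuclideanSpace ℝ (Fin 3)) 1 => gi p.1 p.2) ∧ (∀ u x, gi u (g u x) = x) ∧ (∀ u x, g u (gi u x)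 = x) ∧ ∀ z : (𝓡∂ 4).boundary EquatorTube, invTail ((RegularSublevel.splitDiffeomorph isRegularLevel_tubeS).symm (φ z)).1 = invTail z.1 ∧ ∀ u : Metric.sphere (0 : EuclideanSpace ℝ (Fin 2)) 1, (u : EuclideanSpace ℝ (Fin 2)) = Real.sqrt 2 • invTail z.1 → invHead ((RegularSublevel.splitDiffeomorph isRegularLevel_tubeS).symm (φ z)).1 = g u (invHead z.1) := by
  intro φ hφ
  haveI := fact_finrank_euclideanSpace_succ 1
  haveI := fact_finrank_euclideanSpace_succ 2
  set spl := RegularSublevel.splitDiffeomorph isRegularLevel_tubeS with hspl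
  -- `φ` and `φ⁻¹` preserve the tail
  have hpres : ∀ z : (𝓡∂ 4).boundary EquatorTube, invTail (spl.symm (φ z)).1 = invTail z.1 :=
    fun z => invTail_eq_of_coord_eq _ _ (hφ z).1 (hφ z).2
  have hpres' : ∀ z' : (𝓡∂ 4).boundary PolarTube, invTail (φ.symm z').1 = invTail (spl.symm z').1 := by
    intro z'
    have h := hpres (φ.symm z')
    rw [Diffeomorph.apply_symm_apply] at h
    exact h.symm
  -- the two lifts `(u, θ) ↦ (θ/√2, u/√2)` into `∂W₀` and `∂V₀`
  have hθ : ContMDiff ((𝓡 1).prod (𝓡 2)) (𝓡 2) ∞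
      fun p : Metric.sphere (0 : EuclideanSpace ℝ (Fin 2)) 1 × Metric.sphere (0 : EuclideanSpace ℝ (Fin 3)) 1 =>
        p.2 := contMDiff_snd
  have hw : ContMDiff ((𝓡 1).prod (𝓡 2)) 𝓘(ℝ, EuclideanSpace ℝ (Fin 2)) ∞
      fun p : Metric.sphere (0 : EuclideanSpace ℝ (Fin 2)) 1 × Metric.sphere (0 : EuclideanSpace ℝ (Fin 3)) 1 =>
        (Real.sqrt 2)⁻¹ • (p.1 : EuclideanSpace ℝ (Fin 2)) :=
    (contDiff_const_smul _).comp_contMDiff (contMDiff_coe_sphere.comp contMDiff_fst)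
  have hn : ∀ p : Metric.sphere (0 : EuclideanSpace ℝ (Fin 2)) 1 × Metric.sphere (0 : EuclideanSpace ℝ (Fin 3)) 1,
      sq2 ((Real.sqrt 2)⁻¹ • (p.1 : EuclideanSpace ℝ (Fin 2))) = 1 / 2 := fun p => sq2_smul_sphere p.1
  obtain ⟨Fmk, hFmk, hFmkp⟩ := exists_lift_boundaryW _ _ hθ hw hn
  obtain ⟨Gmk, hGmk, hGmkp⟩ := exists_lift_boundaryV _ _ hθ hw hn
  refine ⟨fun u x => invHead (spl.symm (φ (Fmk (u, x)))).1,
    fun u y => invHead (φ.symm (Gmk (u, y))).1, ?_, ?_, ?_, ?_, ?_⟩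
  · exact contMDiff_invHead_boundaryV.comp (φ.contMDiff.comp hFmk)
  · exact contMDiff_invHead_boundaryW.comp (φ.symm.contMDiff.comp hGmk)
  · intro u x
    have key : Gmk (u, invHead (spl.symm (φ (Fmk (u, x)))).1) = φ (Fmk (u, x)) := by
      apply helper_sliceRec_carriers
      · exact (hGmkp _).1
      · rw [(hGmkp _).2, hpres, (hFmkp _).2]
    show invHead (φ.symm (Gmk (u, invHead (spl.symm (φ (Fmk (u, x)))).1))).1 = x
    rw [key, Diffeomorph.symm_apply_apply, (hFmkp _).1]
  · intro u y
    have key : Fmk (u, invHead (φ.symm (Gmk (u, y))).1) = φ.symm (Gmk (u, y)) := by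
      apply boundaryW_ext
      · exact (hFmkp _).1
      · rw [(hFmkp _).2, hpres', (hGmkp _).2]
    show invHead (spl.symm (φ (Fmk (u, invHead (φ.symm (Gmk (u, y))).1)))).1 = y
    rw [key, Diffeomorph.apply_symm_apply, (hGmkp _).1]
  · intro z
    refine ⟨hpres z, fun u hu => ?_⟩
    have key : Fmk (u, invHead z.1) = z := by
      apply boundaryW_ext
      · exact (hFmkp _).1
      · rw [(hFmkp _).2, hu, inv_smul_sqrt_two_smul]
    show invHead (spl.symm (φ z)).1 = invHead (spl.symm (φ (Fmk (u, invHead z.1)))).1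
    rw [key]

/-! ### Isotopies from paths of circle-families -/

/-- **Registered helper `helper_sliceRec_isotopy`: paths of circle-families suspend to smooth
isotopies.**  Let `H, H⁻¹ : ℝ × 𝕊¹ × S² → S²` be jointly smooth and fibrewise mutually inverse,
and let `χ₀ : ∂W₀ ≅ ∂V₀` be the suspension of `H_0` (`θ(χ₀ z) = H_0 (√2 w(z)) (θ z)`,
`w(χ₀ z) = w(z)`).  Then the suspension of `H_1` is a diffeomorphism `χ₁ : ∂W₀ ≅ ∂V₀` smoothly
isotopic to `χ₀`: the isotopy is `t ↦` suspension of `H_t`, a jointly smooth family (lifts into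
`∂V₀`, Lee 2013, Cor. 5.30) of diffeomorphisms (inverse: the suspension of `H_t⁻¹`), hence of
smooth embeddings (`Diffeomorph.isSmoothEmbedding'`). Hirsch (1976), Ch. 8 §1.
[cite: HirschDT1976, Ch. 8 §1] -/
theorem helper_sliceRec_isotopy : ∀ H Hi : ℝ → Metric.sphere (0 : EuclideanSpace ℝ (Fin 2)) 1 → Metric.sphere (0 : EuclideanSpace ℝ (Fin 3)) 1 → Metric.sphere (0 : EuclideanSpace ℝ (Fin 3)) 1, ContMDiff (𝓘(ℝ, ℝ).prod ((𝓡 1).prod (𝓡 2))) (𝓡 2) ∞ (fun p : ℝ × (Metric.sphere (0 : EuclideanSpace ℝ (Fin 2)) 1 × Metric.sphere (0 : EuclideanSpace ℝ (Fin 3)) 1) => H p.1 p.2.1 p.2.2) → ContMDiff (𝓘(ℝ, ℝ).prod ((𝓡 1).prod (𝓡 2))) (𝓡 2) ∞ (fun p : ℝ × (Metric.sphere (0 : EuclideanSpace ℝ (Fin 2)) 1 × Metric.sphere (0 : EuclideanSpace ℝ (Fin 3)) 1) => Hi p.1 p.2.1 p.2.2) → (∀ t u x, Hi t u (H t u x)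 = x) → (∀ t u x, H t u (Hi t u x) = x) → ∀ χ₀ : (𝓡∂ 4).boundary EquatorTube ≃ₘ⟮𝓡 3, 𝓡 3⟯ (𝓡∂ 4).boundary PolarTube, (∀ z : (𝓡∂ 4).boundary EquatorTube, invTail ((RegularSublevel.splitDiffeomorph isRegularLevel_tubeS).symm (χ₀ z)).1 = invTail z.1 ∧ ∀ u : Metric.sphere (0 : EuclideanSpace ℝ (Fin 2)) 1, (u : EuclideanSpace ℝ (Fin 2)) = Real.sqrt 2 • invTail z.1 → invHead ((RegularSublevel.splitDiffeomorph isRegularLevel_tubeS).symm (χ₀ z)).1 = H 0 u (invHead z.1)) → ∃ χ₁ : (𝓡∂ 4).boundary EquatorTube ≃ₘ⟮𝓡 3, 𝓡 3⟯ (𝓡∂ 4).boundary PolarTube, (∀ z : (𝓡∂ 4).boundary EquatorTube, invTail ((RegularSublevel.splitDiffeomorph isRegularLevel_tubeS).symm (χ₁ z)).1 = invTail z.1 ∧ ∀ u : Metric.sphere (0 : EuclideanSpace ℝ (Fin 2)) 1, (u : EuclideanSpace ℝ (Fin 2)) = Real.sqrt 2 • invTail z.1 → invHead ((RegularSublevel.splitDiffeomorph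 isRegularLevel_tubeS).symm (χ₁ z)).1 = H 1 u (invHead z.1)) ∧ IsSmoothlyIsotopic (𝓡 3) (𝓡 3) χ₀ χ₁ := by
  intro H Hi hH hHi hHiH hHHi χ₀ hχ₀
  haveI := fact_finrank_euclideanSpace_succ 1
  haveI := fact_finrank_euclideanSpace_succ 2
  -- the unit tails
  obtain ⟨uW, huWs, huW⟩ : ∃ uW : (𝓡∂ 4).boundary EquatorTube → Metric.sphere (0 : EuclideanSpace ℝ (Fin 2)) 1,
      ContMDiff (𝓡 3) (𝓡 1) ∞ uW ∧ ∀ z, (uW z : EuclideanSpace ℝ (Fin 2)) = Real.sqrt 2 • invTail z.1 :=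
    ⟨_, contMDiff_unitTail_boundaryW, fun z => rfl⟩
  obtain ⟨uV, huVs, huV⟩ : ∃ uV : (𝓡∂ 4).boundary PolarTube → Metric.sphere (0 : EuclideanSpace ℝ (Fin 2)) 1,
      ContMDiff (𝓡 3) (𝓡 1) ∞ uV ∧ ∀ z, (uV z : EuclideanSpace ℝ (Fin 2)) =
        Real.sqrt 2 • invTail ((RegularSublevel.splitDiffeomorph isRegularLevel_tubeS).symm z).1 :=
    ⟨_, contMDiff_unitTail_boundaryV, fun z => rfl⟩
  -- the forward family of lifts `(t, z) ↦ (H_t (u z) (θ z) /√2, w z) ∈ ∂V₀`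
  have hθF : ContMDiff (𝓘(ℝ, ℝ).prod (𝓡 3)) (𝓡 2) ∞
      fun p : ℝ × (𝓡∂ 4).boundary EquatorTube => H p.1 (uW p.2) (invHead p.2.1) :=
    hH.comp (contMDiff_fst.prodMk ((huWs.comp contMDiff_snd).prodMk
      (contMDiff_invHead_boundaryW.comp contMDiff_snd)))
  have hwF : ContMDiff (𝓘(ℝ, ℝ).prod (𝓡 3)) 𝓘(ℝ, EuclideanSpace ℝ (Fin 2)) ∞
      fun p : ℝ × (𝓡∂ 4).boundary EquatorTube => invTail p.2.1 :=
    contMDiff_invTail_boundaryW.comp contMDiff_snd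
  obtain ⟨F, hF, hFp⟩ := exists_lift_boundaryV _ _ hθF hwF (fun p => sq2_invTail_boundaryW p.2)
  -- the backward family of lifts `(t, z') ↦ (H_t⁻¹ (u z') (θ z') /√2, w z') ∈ ∂W₀`
  have hθG : ContMDiff (𝓘(ℝ, ℝ).prod (𝓡 3)) (𝓡 2) ∞
      fun p : ℝ × (𝓡∂ 4).boundary PolarTube =>
        Hi p.1 (uV p.2) (invHead ((RegularSublevel.splitDiffeomorph isRegularLevel_tubeS).symm p.2).1) :=
    hHi.comp (contMDiff_fst.prodMk ((huVs.comp contMDiff_snd).prodMk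
      (contMDiff_invHead_boundaryV.comp contMDiff_snd)))
  have hwG : ContMDiff (𝓘(ℝ, ℝ).prod (𝓡 3)) 𝓘(ℝ, EuclideanSpace ℝ (Fin 2)) ∞
      fun p : ℝ × (𝓡∂ 4).boundary PolarTube =>
        invTail ((RegularSublevel.splitDiffeomorph isRegularLevel_tubeS).symm p.2).1 :=
    contMDiff_invTail_boundaryV.comp contMDiff_snd
  obtain ⟨G, hG, hGp⟩ := exists_lift_boundaryW _ _ hθG hwG (fun p => sq2_invTail_boundaryV p.2)
  -- unit tails are preserved
  have huF : ∀ t z, uV (F (t, z)) = uW z := fun t z => Subtype.ext (by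
    rw [huV, huW, (hFp (t, z)).2])
  have huG : ∀ t z', uW (G (t, z')) = uV z' := fun t z' => Subtype.ext (by
    rw [huW, huV, (hGp (t, z')).2])
  -- the stages are mutually inverse
  have hleft : ∀ t z, G (t, F (t, z)) = z := by
    intro t z
    apply boundaryW_ext
    · rw [(hGp _).1, huF, (hFp _).1, hHiH]
    · rw [(hGp _).2, (hFp _).2]
  have hright : ∀ t z', F (t, G (t, z')) = z' := by
    intro t z'
    apply helper_sliceRec_carriers
    · rw [(hFp _).1, huG, (hGp _).1, hHHi]
    · rw [(hFp _).2, (hGp _).2]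
  -- the stage diffeomorphisms
  have hstage : ∀ t : ℝ, ContMDiff (𝓡 3) (𝓡 3) ∞ fun z : (𝓡∂ 4).boundary EquatorTube => F (t, z) :=
    fun t => hF.comp (contMDiff_const.prodMk contMDiff_id)
  have hstage' : ∀ t : ℝ, ContMDiff (𝓡 3) (𝓡 3) ∞ fun z' : (𝓡∂ 4).boundary PolarTube => G (t, z') :=
    fun t => hG.comp (contMDiff_const.prodMk contMDiff_id)
  have hχex : ∀ t : ℝ, ∃ e : (𝓡∂ 4).boundary EquatorTube ≃ₘ⟮𝓡 3, 𝓡 3⟯ (𝓡∂ 4).boundary PolarTube,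
      ⇑e = fun z => F (t, z) := fun t =>
    ⟨⟨⟨fun z => F (t, z), fun z' => G (t, z'), hleft t, hright t⟩, hstage t, hstage' t⟩, rfl⟩
  choose χ hχ using hχex
  refine ⟨χ 1, fun z => ⟨?_, fun u hu => ?_⟩, ⟨?_⟩⟩
  · rw [hχ, (hFp _).2]
  · have huz : uW z = u := Subtype.ext (by rw [huW, hu])
    rw [hχ, (hFp _).1, huz]
  · refine
      { toFun := fun t z => F (t, z)
        contMDiff := hF
        isSmoothEmbedding := fun t => ?_
        map_zero := ?_
        map_one := (hχ 1).symm }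
    · rw [← hχ t]
      exact (χ t).isSmoothEmbedding'
    · funext z
      show F (0, z) = χ₀ z
      apply helper_sliceRec_carriers
      · rw [(hFp _).1, ((hχ₀ z).2 (uW z) (huW z))]
      · rw [(hFp _).2, (hχ₀ z).1]

end Summit.SmoothPoincare4.SmoothPoincare4.Cruxes.RungOne.Sketch

end
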